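import Summits.AtomisticToContinuum.BoseEinsteinCondensation.Theorems.ParticleTensorisation.Negative.PosdefDressingDobrushin
import Summits.AtomisticToContinuum.BoseEinsteinCondensation.Theorems.ParticleTensorisation.Negative.PosdefDressingHypothesis
import Summits.AtomisticToContinuum.BoseEinsteinCondensation.Theorems.ParticleTensorisation.Negative.PosdefDressingConclusion
import Summits.AtomisticToContinuum.BoseEinsteinCondensation.Theorems.ParticleTensorisation.Negative.PosdefDressingEnergy
import Summits.AtomisticToContinuum.BoseEinsteinCondensation.Theorems.ParticleTensorisation.Negative.PosdefDressingCurieWeiss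

/-!
# Crux `ParticleTensorisation` (stmt-AtomisticToContinuum-14367) — `Negative/`:
# the criterion stub `stub_posdefDressing` of line `registered` is FALSE (assembly, file F)

`stub_posdefDressing` (skeleton `Cruxes/ParticleTensorisation/Lines/birth.lean`, line
birth-posdef-undressing) asserts ONE pair `(u₀, C₀)` such that for all `N, L`, all measurable
amplitudes `A` and all continuous even Bochner-positive-definite `U` with `|U| ≤ u₀`, approximate
tensorisation of the undressed law `|A e^{E/2}|²` with constant `C₁` implies it for `|A|²` with
constant `C₀ C₁` (`E = ∑_{k<l} U(x_k - x_l)`). Refutation: given `(u₀, C₀)` put `u = min(u₀,1)`,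
take `N` large, `L = 3`, the positive-type kernel `U = (u/(N-1)) ∑_{m<N} cos(2π(x₀ + m x₁))`
(file K), private wells and the Curie–Weiss reference weight `w` at `β₁ = bN = 1 - u/2 - u/(N-1)`
(file W1), `A = √w e^{-E/2}`. Dobrushin (file W2) + the conversion (file H) PROVE the hypothesis
with `C₁ = 2/u`; on the wells `E` is the Curie–Weiss energy at coupling `u/(N-1)` (files K, E), so
`|A|²` is Curie–Weiss at `β₂ = 1 + u/2 > 1`, whose magnetised shell beats the balanced one by
`e^{cN}` (file C), and the conclusion clause fails (file X2). Hence no `(u₀, C₀)` exists: the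
LINE is dead by a theorem (the crux `ParticleTensorisation` itself is not touched).
-/

noncomputable section

namespace Summit.AtomisticToContinuum.BoseEinsteinCondensation.Theorems.PosdefDressingNeg

open MeasureTheory Function Finset Set
open scoped ENNReal
open Literature.MathematicalPhysics.QuantumManyBody.BoseGas

/-- **`stub_posdefDressing` is false.** The registered signature of the criterion stub of line
`registered` (birth-posdef-undressing) of crux `ParticleTensorisation`, negated; see the module
docstring for the construction (positive type hides a mean-field ferromagnet of strength `u₀`,
which tips a near-critical Dobrushin reference). [folklore] -/
theorem stub_posdefDressing_false :
    ¬ (∃ u₀ : ℝ, 0 < u₀ ∧ ∃ C₀ : ℝ, 0 < C₀ ∧ ∀ (N : ℕ) (L : ℝ) (A : (Fin N → EuclideanSpace ℝ (Fin 3))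
      → ℂ), Measurable A → ∀ U : EuclideanSpace ℝ (Fin 3) → ℝ, Continuous U → (∀ x, U (-x) = U x) →
      Literature.Analysis.FunctionSpaces.IsPositiveDefinite (fun x => (U x : ℂ)) → (∀ x, |U x| ≤ u₀)
      → ∀ C₁ : ℝ, 0 < C₁ → (∀ (F : (Fin N → EuclideanSpace ℝ (Fin 3)) → ℂ) (g : Fin N → (Fin N →
      EuclideanSpace ℝ (Fin 3)) → ℂ), Measurable F → (∀ i, Measurable (g i)) → (∃ M : ℝ, ∀ X, ‖F X‖
      ≤ M ∧ ∀ i, ‖g i X‖ ≤ M) → (∀ i X x, g i (Function.update X i x) = g i X) → ∃ c : ℂ, (∫⁻ X in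
      boxN N L, (‖F X - c * (A X * (Real.exp ((∑ k : Fin N, ∑ l : Fin N with k < l, U (X k - X l)) /
      2) : ℂ))‖₊ : ℝ≥0∞) ^ 2) ≤ ENNReal.ofReal C₁ * ∑ i : Fin N, ∫⁻ X in boxN N L, (‖F X - g i X *
      (A X * (Real.exp ((∑ k : Fin N, ∑ l : Fin N with k < l, U (X k - X l)) / 2) : ℂ))‖₊ : ℝ≥0∞) ^
      2) → (∀ (F : (Fin N → EuclideanSpace ℝ (Fin 3)) → ℂ) (g : Fin N → (Fin N → EuclideanSpace ℝ
      (Fin 3)) → ℂ), Measurable F → (∀ i, Measurable (g i)) → (∃ M : ℝ, ∀ X, ‖F X‖ ≤ M ∧ ∀ i, ‖g i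
      X‖ ≤ M) → (∀ i X x, g i (Function.update X i x) = g i X) → ∃ c : ℂ, (∫⁻ X in boxN N L, (‖F X -
      c * A X‖₊ : ℝ≥0∞) ^ 2) ≤ ENNReal.ofReal (C₀ * C₁) * ∑ i : Fin N, ∫⁻ X in boxN N L, (‖F X - g i
      X * A X‖₊ : ℝ≥0∞) ^ 2)) := by
  rintro ⟨u₀, hu₀, C₀, hC₀, h⟩
  -- constants
  obtain ⟨u, hu⟩ : ∃ u : ℝ, u = min u₀ 1 := ⟨_, rfl⟩
  have hu0 : 0 < u := by rw [hu]; exact lt_min hu₀ one_pos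
  have hu1 : u ≤ 1 := by rw [hu]; exact min_le_right _ _
  have huu₀ : u ≤ u₀ := by rw [hu]; exact min_le_left _ _
  have hβ : (1 : ℝ) < 1 + u / 2 := by linarith
  have hC₁ : (0 : ℝ) < 2 / u := by positivity
  have hC₁1 : (1 : ℝ) ≤ 2 / u := by rw [le_div_iff₀ hu0]; linarith
  obtain ⟨c, hc, N₁, _, hshells⟩ := cw_shells hβ
  obtain ⟨N₀, hN₀⟩ := exists_nat_mul_lt_exp hc (2 * Real.exp 2 * (C₀ * (2 / u)))
  obtain ⟨N, hN⟩ : ∃ N : ℕ, N = max (max N₁ N₀) 3 := ⟨_, rfl⟩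
  have hNN₁ : N₁ ≤ N := by rw [hN]; exact (le_max_left _ _).trans (le_max_left _ _)
  have hNN₀ : N₀ ≤ N := by rw [hN]; exact (le_max_right _ _).trans (le_max_left _ _)
  have hN3 : 3 ≤ N := by rw [hN]; exact le_max_right _ _
  have hN2 : 2 ≤ N := by omega
  have hNpos : 0 < N := by omega
  have hNr : (3 : ℝ) ≤ N := by exact_mod_cast hN3
  have hN1 : (2 : ℝ) ≤ (N : ℝ) - 1 := by linarith
  obtain ⟨j₁, hj₁, hj₁N, hshell, -⟩ := hshells N hNN₁
  have hbig := hN₀ N hNN₀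
  -- parameters of the construction
  obtain ⟨a, ha⟩ : ∃ a : ℝ, a = 1 / (16 * (N : ℝ) ^ 3) := ⟨_, rfl⟩
  have ha0 : 0 < a := by rw [ha]; positivity
  have ha4 : a ≤ 1 / 4 := by
    rw [ha, div_le_div_iff₀ (by positivity) (by norm_num)]
    nlinarith [pow_le_pow_left₀ (by norm_num : (0 : ℝ) ≤ 3) hNr 3]
  obtain ⟨b, hb⟩ : ∃ b : ℝ, b = (1 - u / 2 - u / ((N : ℝ) - 1)) / N := ⟨_, rfl⟩
  have hb0 : 0 ≤ b := by
    rw [hb]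
    refine div_nonneg ?_ (by positivity)
    have : u / ((N : ℝ) - 1) ≤ u / 2 := div_le_div_of_nonneg_left hu0.le two_pos hN1
    linarith
  have hbN : b * N = 1 - u / 2 - u / ((N : ℝ) - 1) := by
    rw [hb]; field_simp
  have hr : ((N : ℝ) - 1) * b < 1 := by
    have h1 : ((N : ℝ) - 1) * b ≤ N * b := mul_le_mul_of_nonneg_right (by linarith) hb0
    have h2 : (N : ℝ) * b = 1 - u / 2 - u / ((N : ℝ) - 1) := by rw [mul_comm, hbN]
    have h3 : 0 < u / ((N : ℝ) - 1) := div_pos hu0 (by linarith)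
    linarith
  have hrC : (1 - ((N : ℝ) - 1) * b)⁻¹ ≤ 2 / u := by
    have h1 : ((N : ℝ) - 1) * b ≤ N * b := mul_le_mul_of_nonneg_right (by linarith) hb0
    have h2 : (N : ℝ) * b = 1 - u / 2 - u / ((N : ℝ) - 1) := by rw [mul_comm, hbN]
    have h3 : 0 < u / ((N : ℝ) - 1) := div_pos hu0 (by linarith)
    have h4 : u / 2 ≤ 1 - ((N : ℝ) - 1) * b := by linarith
    rw [inv_le_comm₀ (by linarith) hC₁, inv_div]
    exact h4
  have hβ₂ : b * N + u * N / ((N : ℝ) - 1) = 1 + u / 2 := by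
    rw [hbN]; field_simp; ring
  -- the objects (opaque constants with defining equations)
  obtain ⟨qp, hqp⟩ : ∃ qp : Fin N → Fin 3 → ℝ, ∀ k, qp k = ![1, 1 + (k : ℝ) / N, 1] := ⟨_, fun _ => rfl⟩
  obtain ⟨qm, hqm⟩ : ∃ qm : Fin N → Fin 3 → ℝ, ∀ k, qm k = ![3 / 2, 1 + (k : ℝ) / N, 1] :=
    ⟨_, fun _ => rfl⟩
  obtain ⟨Wp, hWp⟩ : ∃ Wp : Fin N → Set Space,
      ∀ k, Wp k = {x : Space | ∀ i, x i ∈ Ioo (qp k i) (qp k i + a)} := ⟨_, fun _ => rfl⟩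
  obtain ⟨Wm, hWm⟩ : ∃ Wm : Fin N → Set Space,
      ∀ k, Wm k = {x : Space | ∀ i, x i ∈ Ioo (qm k i) (qm k i + a)} := ⟨_, fun _ => rfl⟩
  obtain ⟨s, hs⟩ : ∃ s : Space → ℝ, ∀ x, s x = if x 0 < 5 / 4 then 1 else -1 := ⟨_, fun _ => rfl⟩
  obtain ⟨χ, hχ⟩ : ∃ χ : Fin N → Space → ℝ,
      ∀ k x, χ k x = (Wp k ∪ Wm k).indicator (fun _ => (1 : ℝ)) x := ⟨_, fun _ _ => rfl⟩
  obtain ⟨M, hM⟩ : ∃ M : (Fin N → Space) → ℝ, ∀ X, M X = ∑ k, s (X k) := ⟨_, fun _ => rfl⟩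
  obtain ⟨Mj, hMj⟩ : ∃ Mj : Fin N → (Fin N → Space) → ℝ,
      ∀ j X, Mj j X = ∑ k ∈ univ.erase j, s (X k) := ⟨_, fun _ _ => rfl⟩
  obtain ⟨w, hw⟩ : ∃ w : (Fin N → Space) → ℝ,
      ∀ X, w X = (∏ k, χ k (X k)) * Real.exp (b * ((M X) ^ 2 - (N : ℝ) ^ 2) / 2) := ⟨_, fun _ => rfl⟩
  obtain ⟨π, hπ⟩ : ∃ π : Fin N → (Fin N → Space) → ℝ,
      ∀ j X, π j X = χ j (X j) * Real.exp (b * (s (X j) * Mj j X - ((N : ℝ) - 1))) :=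
    ⟨_, fun _ _ => rfl⟩
  obtain ⟨B, hB⟩ : ∃ B : Fin N → (Fin N → Space) → ℝ, ∀ j X, B j X = (∏ k ∈ univ.erase j, χ k (X k)) *
      Real.exp (b * ((Mj j X) ^ 2 - ((N : ℝ) - 1) ^ 2) / 2) := ⟨_, fun _ _ => rfl⟩
  obtain ⟨uL, huL⟩ : ∃ uL : Measure Space,
      uL = (ENNReal.ofReal ((3 : ℝ) ^ 3))⁻¹ • volume.restrict (box 3) := ⟨_, rfl⟩
  obtain ⟨S', hS'⟩ : ∃ S' : Fin N → ((Fin N → Space) → ℝ) → (Fin N → Space) → ℝ,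
      ∀ j G X, S' j G X = ∫ y, G (update X j y) ∂uL := ⟨_, fun _ _ _ => rfl⟩
  obtain ⟨T', hT'⟩ : ∃ T' : Fin N → ((Fin N → Space) → ℝ) → (Fin N → Space) → ℝ,
      ∀ j F X, T' j F X = S' j (fun Y => F Y * π j Y) X / S' j (π j) X := ⟨_, fun _ _ _ => rfl⟩
  obtain ⟨P', hP'⟩ : ∃ P' : ((Fin N → Space) → ℝ) → (Fin N → Space) → ℝ,
      ∀ F X, P' F X = (Fintype.card (Fin N) : ℝ)⁻¹ * ∑ j, T' j F X := ⟨_, fun _ _ => rfl⟩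
  obtain ⟨U, hU⟩ : ∃ U : Space → ℝ, ∀ y, U y = u / ((N : ℝ) - 1) *
      ∑ m ∈ range (N - 1), Real.cos (2 * Real.pi * (y 0 + (m + 1 : ℝ) * y 1)) := ⟨_, fun _ => rfl⟩
  set E : (Fin N → Space) → ℝ := fun X => ∑ k : Fin N, ∑ l : Fin N with k < l, U (X k - X l) with hEdef
  have hE : ∀ X, E X = ∑ k : Fin N, ∑ l : Fin N with k < l, U (X k - X l) := fun X => rfl
  obtain ⟨A, hA⟩ : ∃ A : (Fin N → Space) → ℂ,
      ∀ X, A X = ((Real.sqrt (w X) * Real.exp (-(E X) / 2) : ℝ) : ℂ) := ⟨_, fun _ => rfl⟩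
  -- facts about `U`
  have hUc := continuous_U hU
  have hUe := U_neg hU
  have hUpd := isPositiveDefinite_U hu0.le hN2 hU
  have hUb : ∀ x, |U x| ≤ u₀ := fun x => (abs_U_le hu0.le hU x).trans huu₀
  -- facts about `w`, `E`, `A`
  have hwm := (w_mem hb0 hs hWp hWm hχ hM hw).1
  have hw01 := (w_mem hb0 hs hWp hWm hχ hM hw).2
  have hwlow : ∀ X, w X ≠ 0 → Real.exp (-(b * (N : ℝ) ^ 2)) ≤ w X := fun X hX =>
    exp_le_w hb0 hχ hw fun k => by
      by_contra hk
      exact hX (w_eq_zero hχ hw hk)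
  have hEm : Measurable E := measurable_E hUc hE
  have hMm : Measurable M := measurable_M hs hM
  have hAm : Measurable A := by
    have : A = fun X => ((Real.sqrt (w X) * Real.exp (-(E X) / 2) : ℝ) : ℂ) := funext hA
    rw [this]
    exact Complex.measurable_ofReal.comp (hwm.sqrt.mul (hEm.neg.div_const 2).exp)
  -- the HYPOTHESIS clause holds with `C₁ = 2/u`
  have hAT : ∀ (Fr : (Fin N → Space) → ℝ) (gr : Fin N → (Fin N → Space) → ℝ) (Mb : ℝ),
      Measurable Fr → (∀ X, |Fr X| ≤ Mb) → (∀ j, Measurable (gr j)) → (∀ j X, |gr j X| ≤ Mb) →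
      (∀ j X y, gr j (update X j y) = gr j X) →
      ∫ X, (Fr X - (∫ Y, Fr Y * w Y ∂(Measure.pi fun _ => uL)) /
          (∫ Y, w Y ∂(Measure.pi fun _ => uL))) ^ 2 * w X ∂(Measure.pi fun _ => uL) ≤
        2 / u * ∑ j, ∫ X, (Fr X - gr j X) ^ 2 * w X ∂(Measure.pi fun _ => uL) := by
    intro Fr gr Mb hFrm hFrb hgrm hgrb hgr
    refine (cw_weighted_AT hNpos hb0 hr hs hqp hqm hWp hWm ha0 ha4 hχ hM hMj hw hπ hB huL hS' hT'
      hP' hFrm hFrb hgrm hgrb hgr).trans (mul_le_mul_of_nonneg_right hrC ?_)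
    exact Finset.sum_nonneg fun j _ => integral_nonneg fun X => mul_nonneg (sq_nonneg _) (hw01 X).1
  have HYP := amplitude_clause_of_weighted_AT hNpos huL hwm hw01 (Real.exp_pos _) hwlow hC₁1 hAT E hA
  -- hence the CONCLUSION clause with constant `C₀ · (2/u)`
  have CONCL := h N 3 A hAm U hUc hUe hUpd hUb (2 / u) hC₁ HYP
  -- the test data
  obtain ⟨F, hF⟩ : ∃ F : (Fin N → Space) → ℂ, ∀ X, F X = if 0 < M X then A X else 0 :=
    ⟨_, fun _ => rfl⟩
  obtain ⟨g, hg⟩ : ∃ g : Fin N → (Fin N → Space) → ℂ, ∀ i X, g i X = if 0 < Mj i X then 1 else 0 :=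
    ⟨_, fun _ _ => rfl⟩
  have hFm : Measurable F := by
    have : F = fun X => if 0 < M X then A X else 0 := funext hF
    rw [this]
    exact Measurable.ite (measurableSet_lt measurable_const hMm) hAm measurable_const
  have hgm : ∀ i, Measurable (g i) := fun i => by
    have : g i = fun X => if 0 < Mj i X then (1 : ℂ) else 0 := funext (hg i)
    rw [this]
    exact Measurable.ite (measurableSet_lt measurable_const (measurable_Mj hs hMj i))
      measurable_const measurable_const
  have hAb : ∀ X, ‖A X‖ ≤ Real.exp ((N : ℝ) ^ 2 * u / 2) := by
    intro X
    rw [hA, Complex.norm_real, Real.norm_eq_abs, abs_mul, abs_of_nonneg (Real.sqrt_nonneg _),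
      abs_of_nonneg (Real.exp_pos _).le]
    have h1 : Real.sqrt (w X) ≤ 1 := Real.sqrt_le_one.mpr (hw01 X).2 |>.trans_eq' (by rfl)
    have h2 : Real.exp (-(E X) / 2) ≤ Real.exp ((N : ℝ) ^ 2 * u / 2) := by
      refine Real.exp_le_exp.mpr ?_
      have := abs_E_le hu0.le hU hE X
      rw [abs_le] at this
      linarith
    calc Real.sqrt (w X) * Real.exp (-(E X) / 2) ≤ 1 * Real.exp ((N : ℝ) ^ 2 * u / 2) :=
          mul_le_mul h1 h2 (Real.exp_pos _).le zero_le_one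
      _ = _ := one_mul _
  have hbd : ∃ Mb : ℝ, ∀ X, ‖F X‖ ≤ Mb ∧ ∀ i, ‖g i X‖ ≤ Mb := by
    refine ⟨Real.exp ((N : ℝ) ^ 2 * u / 2) + 1, fun X => ⟨?_, fun i => ?_⟩⟩
    · rw [hF]
      split_ifs
      · linarith [hAb X]
      · rw [norm_zero]; positivity
    · rw [hg]
      split_ifs
      · rw [norm_one]; linarith [Real.exp_pos ((N : ℝ) ^ 2 * u / 2)]
      · rw [norm_zero]; positivity
  have hgupd : ∀ i X x, g i (update X i x) = g i X := fun i X x => by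
    rw [hg, hg, Mj_update_self hMj]
  obtain ⟨cc, hcc⟩ := CONCL F g hFm hgm hbd hgupd
  -- the energy on the wells is Curie–Weiss within `1`
  have hEapprox : ∀ X : Fin N → Space, (∀ k, X k ∈ Wp k ∪ Wm k) →
      |E X + u / ((N : ℝ) - 1) * ((M X) ^ 2 - N) / 2| ≤ 1 := by
    intro X hX
    refine (abs_E_add_le hu0.le hN2 hU hs hqp hqm hWp hWm ha0.le ha4 hM hE hX).trans ?_
    rw [ha]
    have hπ4 := Real.pi_le_four
    have hNr0 : (0 : ℝ) < N := by linarith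
    have : (N : ℝ) ^ 2 * (4 * Real.pi * u * N * (1 / (16 * (N : ℝ) ^ 3))) = Real.pi * u / 4 := by
      field_simp
      ring
    rw [this]
    nlinarith [Real.pi_pos]
  -- the shell comparison at the dressed inverse temperature `1 + u/2`
  rw [← hβ₂] at hshell
  exact cw_not_clause hN2 hs hqp hqm hWp hWm ha0 ha4 hχ hM hMj hw hA hEapprox hAm hMm hF hg
    (by positivity : (0 : ℝ) ≤ C₀ * (2 / u)) hj₁ hj₁N hshell hbig ⟨cc, hcc⟩

end Summit.AtomisticToContinuum.BoseEinsteinCondensation.Theorems.PosdefDressingNeg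

end
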